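import Summits.BirchSwinnertonDyer.BirchSwinnertonDyer.Theorems.AlignedTransportAtTwoMainConjectureOfRankZeroBSDAtTwoFineRoadRealKummerLine
import Literature.NumberTheory.EllipticCurves.FineSelmerCoefficientMapProofs
import HarnessLib

/-!
# The EXACT `E[2]`-twin of the strict statement (A)₂ on the `Δ_E > 0` half-cell: `Sel₀(ℚ_∞, E[2^∞])[2]` is finite iff the
# KUMMER-LINE fine group of `E[2]`-classes (fine at the finite places, value on the line `{O, T_w}` at every real place-conjugate) is finite

Cell `bsd-f1-sign2`, WIDTH-5 attach seat `bsd-line-att-p5` (gen 9) on line `birth` of crux C2 stmt-BirchSwinnertonDyer-22298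
`MainConjectureOfRankZeroBSDAtTwo` (route `AlignedTransportAtTwo`); sequel of `…FineRoadRealKummerLine` (att-p5 g9). A
`--supports 22298 --as helper` file. HONEST FRAMING: THEOREMS ONLY — no definition, no named fact, no `sorry`; C2-NEUTRAL (the verdict
«blocked-on GreenbergMuConjectureIrreducible» is untouched); BSD is NOT proved by any of this.

WHY. The lead's note PERFECT-DESCENT §3 (v) read statement (A)₂ — «`Sel₀(ℚ_∞, E[2^∞])[2]` is finite» (⟺ `X₀` torsion with `μ = 0`;
the fine half of the census certificate) — on the `2`-torsion module as «`Sel₀(ℚ_∞, E[2])` is finite». att-p5 g4/g5 proved the relaxed-at-`∞`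
version in both directions and the strict version only as «(A)₂ ⟹ `Sel₀(ℚ_∞, E[2])` finite», and flagged (crux workfile
RELAXED-COEFFICIENTS-att-p5 §3) that on the `Δ_E > 0` half-cell the strict `E[2]`-reading asks too much at the `2ⁿ` real places of `ℚ_n`.
This file states the EXACT twin: (A)₂ ⟺ finiteness of the PULL-BACK `ι_*⁻¹(Sel₀(ℚ_∞, E[2^∞])) ≤ H¹(ℚ_∞, E[2])` (any number field and
any `p`, §1: `ι_*` has finite kernel and hits every `p`-torsion class), and identifies the pull-back for `(ℚ, 2, Δ_E > 0)` (§2): the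
finite-place conditions pulled back, and at the real place the KUMMER LINE «`ev_w(conj_σ y) ∈ {O, T_w}` for every `σ`» of
`…FineRoadRealKummerLine` (one bit per real place-conjugate, between the strict `E[2]`-condition — two bits — and none).

* §1 (any number field `K`, elliptic `E`, prime `p`, `ℤ_p`-extension `κ`): **`finite_fineSelmerInfty_pTorsion_iff_finite_comap`**
  (`Sel₀(K_∞, E[p^∞])[p]` finite ⟺ `ι_*⁻¹(Sel₀(K_∞, E[p^∞]))` finite), `mem_comap_fineSelmerInfty_iff` (membership place by place,
  `ι_*` commuting with `conj_σ`), `fineSelmerInfty_torsion_le_comap` (`Sel₀(K_∞, E[p]) ≤` the pull-back).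
* §2 (`E/ℚ`, `p = 2`, `Δ_E > 0`, `g ∈ ker κ ⊓ D_w` non-trivial): **`exists_kummerLetter_mem_comap_fineSelmerInfty_iff`** (the pull-back
  is the Kummer-line fine group), **`exists_kummerLetter_finite_twoTorsion_iff`** ((A)₂ ⟺ the Kummer-line fine group is finite),
  `finite_twoTorsion_iff_finite_comap`, `exists_ne_one_and_smul_eq_self` (the hypotheses hold for the cyclotomic `κ`),
  `fineSelmerInfty_twoCoeff_le_comap`.

References: R. Greenberg, LNM 1716 (1999) §3 (Lemma 3.1), §4 (Lemma 4.6, p. 106), §5 p. 114; M. F. Lim, R. Sujatha, *Fine Selmer groups of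
congruent Galois representations*, J. Number Theory 187 (2018) §3 (proof of Prop. 3.2); J. Coates, R. Sujatha, Math. Ann. 331 (2005) §3;
J. H. Silverman, *AEC* X.1; crux workfiles `PERFECT-DESCENT.md` §3 (v), `RELAXED-COEFFICIENTS-att-p5.md` §3/§8 (cell bsd-f1-sign2).
-/

set_option autoImplicit false
-- the Theorems namespace of this sub repeats the summit name by design (D-0017 nested layout)
set_option linter.dupNamespace false

noncomputable section

open scoped Classical

namespace Summit.BirchSwinnertonDyer.BirchSwinnertonDyer.Theorems.AlignedTransportAtTwoFineRoad.RealKummerSelmer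

open WeierstrassCurve NumberField IsDedekindDomain Field Literature.NumberTheory.EllipticCurves
  Literature.NumberTheory.EllipticCurves.GreenbergSelmer Literature.NumberTheory.GaloisRepresentations
  Literature.NumberTheory.EllipticCurves.DokchitserDokchitser2012
  Summit.BirchSwinnertonDyer.BirchSwinnertonDyer.Theorems.AlignedTransportAtTwoFineRoad
  Summit.BirchSwinnertonDyer.BirchSwinnertonDyer.Theorems.AlignedTransportAtTwoFineRoad.RealKummerWitnessPrelim
  Summit.BirchSwinnertonDyer.BirchSwinnertonDyer.Theorems.AlignedTransportAtTwoFineRoad.RealKummerValues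
  Summit.BirchSwinnertonDyer.BirchSwinnertonDyer.Theorems.AlignedTransportAtTwoFineRoad.RealKummerIndex
  Summit.BirchSwinnertonDyer.BirchSwinnertonDyer.Theorems.AlignedTransportAtTwoFineRoad.RealKummerLine

/-! ## §1 Any number field, any `p`: `Sel₀(K_∞, E[p^∞])[p]` is finite iff `ι_*⁻¹(Sel₀(K_∞, E[p^∞])) ≤ H¹(K_∞, E[p])` is finite -/

section Generic

variable {K : Type} [Field K] [NumberField K] (W : WeierstrassCurve K) [W.IsElliptic] {p : ℕ} [Fact p.Prime]
  (κ : ZpExtension K p)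

/-- **The EXACT `E[p]`-twin of statement (A)ₚ is the pull-back.** For any number field `K`, elliptic `E = W`, prime `p` and
`ℤ_p`-extension `κ` (`K_∞ = K̄^{ker κ}`): `Sel₀(K_∞, E[p^∞])[p]` is finite iff the pull-back `ι_*⁻¹(Sel₀(K_∞, E[p^∞]))` of the strict
fine Selmer group along `ι_* = (E[p] ↪ E[p^∞])_* : H¹(K_∞, E[p]) → H¹(K_∞, E[p^∞])` (tree `torsionToPrimaryH1Sub`) is finite: `ι_*`
has finite kernel `E(K_∞)[p^∞]/p` (`finite_ker_torsionToPrimaryH1Sub`) and hits every `p`-torsion class (`exists_torsionToPrimaryH1Sub_eq`).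
(The Literature's `E[p]`-fine group `Sel₀(K_∞, E[p])` — «locally trivial at every place» — sits INSIDE the pull-back; at `(ℚ, 2, Δ_E > 0)`
strictly as a condition at the real places, crux workfile RELAXED-COEFFICIENTS-att-p5 §3/§8.) [cite: LimSujatha2018, §3 (proof of Prop. 3.2)]
[cite: GreenbergLNM1716, §3 (proof of Lemma 3.1) and §5 p. 114] -/
theorem finite_fineSelmerInfty_pTorsion_iff_finite_comap :
    Set.Finite {s : W.fineSelmerInfty κ | p • s = 0} ↔
      Set.Finite ((W.fineSelmerInfty κ).comap (W.torsionToPrimaryH1Sub p κ.kerSubgroup) :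
        Set (subgroupH1 κ.kerSubgroup ↥(W.geomTorsion (p : ℤ)))) := by
  set ι := W.torsionToPrimaryH1Sub p κ.kerSubgroup with hι
  set T : Set (W.subgroupH1 p κ.kerSubgroup) := {x | x ∈ W.fineSelmerInfty κ ∧ p • x = 0} with hT
  have hTeq : T = (fun s : W.fineSelmerInfty κ ↦ (s : W.subgroupH1 p κ.kerSubgroup)) '' {s : W.fineSelmerInfty κ | p • s = 0} := by
    ext x
    simp only [hT, Set.mem_setOf_eq, Set.mem_image]
    constructor
    · rintro ⟨hx, hpx⟩
      exact ⟨⟨x, hx⟩, Subtype.ext (by rw [AddSubgroupClass.coe_nsmul]; exact hpx), rfl⟩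
    · rintro ⟨s, hs, rfl⟩
      exact ⟨s.2, by rw [← AddSubgroupClass.coe_nsmul, hs]; rfl⟩
  constructor
  · intro hfin
    have hTfin : T.Finite := by rw [hTeq]; exact hfin.image _
    have hker : ((ι.ker : AddSubgroup (subgroupH1 κ.kerSubgroup (geomTorsion W (p : ℤ)))) :
        Set (subgroupH1 κ.kerSubgroup (geomTorsion W (p : ℤ)))).Finite :=
      W.finite_ker_torsionToPrimaryH1Sub p (H := κ.kerSubgroup) W.zsmul_geomPoints_surjective_holds
    refine (AddMonoidHom.finite_preimage_of_finite_ker ι hker hTfin).subset fun y hy ↦ ?_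
    exact ⟨hy, FineSelmerCoefficientMap.p_smul_torsionToPrimaryH1Sub_eq_zero W κ.kerSubgroup y⟩
  · intro hfin
    -- `{s | p s = 0} ⊆ ι (comap)`, a finite set
    have hsub : T ⊆ ι '' ((W.fineSelmerInfty κ).comap ι : Set (subgroupH1 κ.kerSubgroup ↥(W.geomTorsion (p : ℤ)))) := by
      rintro x ⟨hx, hpx⟩
      obtain ⟨y, rfl⟩ := W.exists_torsionToPrimaryH1Sub_eq p W.zsmul_geomPoints_surjective_holds hpx
      exact ⟨y, hx, rfl⟩
    have hTfin : T.Finite := (hfin.image ι).subset hsub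
    rw [hTeq] at hTfin
    exact Set.Finite.of_finite_image hTfin Subtype.val_injective.injOn

omit [W.IsElliptic] in
/-- **Membership in the pull-back**: `y ∈ ι_*⁻¹(Sel₀(K_∞, E[p^∞]))` iff for every `σ ∈ Γ_K` the push-forward of the conjugate class
`ι_*(conj_σ y)` restricts to zero on `ker κ ⊓ D_v` for every finite place `v` and lies in `infKer (ker κ) E[p^∞] w` for every infinite
place `w` (`mem_fineSelmerInfty_iff_resOfLe` + `ι_*` commutes with `conj_σ`). [cite: Greenberg1989, §1 p. 98]
[cite: CoatesSujatha2005, §3 (the definition of `R(E/F_∞)`)] -/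
theorem mem_comap_fineSelmerInfty_iff (y : subgroupH1 κ.kerSubgroup ↥(W.geomTorsion (p : ℤ))) :
    y ∈ (W.fineSelmerInfty κ).comap (W.torsionToPrimaryH1Sub p κ.kerSubgroup) ↔
      (∀ (v : HeightOneSpectrum (𝓞 K)) (σ : absoluteGaloisGroup K),
          resOfLe (↥(W.geomPrimaryTorsion p)) (inf_le_left : κ.kerSubgroup ⊓ decomp v ≤ κ.kerSubgroup)
            (W.torsionToPrimaryH1Sub p κ.kerSubgroup (conjH1 κ.kerSubgroup (↥(W.geomTorsion (p : ℤ))) σ y)) = 0) ∧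
        ∀ (w : InfinitePlace K) (σ : absoluteGaloisGroup K),
          W.torsionToPrimaryH1Sub p κ.kerSubgroup (conjH1 κ.kerSubgroup (↥(W.geomTorsion (p : ℤ))) σ y) ∈
            infKer κ.kerSubgroup (↥(W.geomPrimaryTorsion p)) w := by
  rw [AddSubgroup.mem_comap]
  have h := FineSelmerCoefficientMap.mem_fineSelmerInfty_iff_resOfLe (M := ↥(W.geomPrimaryTorsion p)) κ
    (W.torsionToPrimaryH1Sub p κ.kerSubgroup y)
  have hfs : W.fineSelmerInfty κ = fineSelmerInfty (↥(W.geomPrimaryTorsion p)) κ := rfl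
  rw [hfs, h]
  simp only [← WeierstrassCurve.conjH1_torsionToPrimaryH1Sub, infKer, AddMonoidHom.mem_ker]

omit [W.IsElliptic] in
/-- `Sel₀(K_∞, E[p]) ≤ ι_*⁻¹(Sel₀(K_∞, E[p^∞]))` (Literature `torsionToPrimaryH1Sub_mem_fineSelmerInfty`).
[cite: LimSujatha2018, §3 (the map `R_S(A[π]) → R_S(A)[π]`)] -/
theorem fineSelmerInfty_torsion_le_comap :
    fineSelmerInfty (↥(W.geomTorsion (p : ℤ))) κ ≤ (W.fineSelmerInfty κ).comap (W.torsionToPrimaryH1Sub p κ.kerSubgroup) := by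
  intro y hy
  rw [AddSubgroup.mem_comap]
  exact FineSelmerCoefficientMap.torsionToPrimaryH1Sub_mem_fineSelmerInfty (W := W) (κ := κ) hy

end Generic

/-! ## §2 `E/ℚ`, `p = 2`, `Δ_E > 0`: the pull-back is the KUMMER-LINE fine group; the exact `E[2]`-twin of (A)₂ -/

section RatTwo

variable (W : WeierstrassCurve ℚ) [W.IsElliptic] (κ : ZpExtension ℚ 2)

/-- **The pull-back `ι_*⁻¹(Sel₀(ℚ_∞, E[2^∞]))` is the KUMMER-LINE fine group** (`Δ_E > 0`, any `ℤ₂`-extension `κ` of `ℚ` whose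
`ker κ` meets `D_w` non-trivially — e.g. the cyclotomic one): an `E[2]`-class `y ∈ H¹(ℚ_∞, E[2])` pushes forward into the strict fine
Selmer group iff (i) for every finite place `v` and every `σ`, `ι_*(conj_σ y)` restricts to zero on `ker κ ⊓ D_v` (the finite Kummer =
fine conditions, pulled back), and (ii) for every `σ`, the VALUE of `conj_σ y` at the complex conjugation `g ∈ ker κ ⊓ D_w` lies on the
Kummer line `{O, T_w}` (`RealKummerLine`: the real condition pulled back to `E[2]` is the line spanned by the Kummer letter `T_w`, the
`2`-torsion point with the least real abscissa). [cite: GreenbergLNM1716, §4 Lemma 4.6 and p. 106] [cite: CoatesSujatha2005, §3]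
[cite: SilvermanAEC2009, X.1 (Prop. 1.4)] -/
theorem exists_kummerLetter_mem_comap_fineSelmerInfty_iff (hΔ : 0 < W.Δ) (w : InfinitePlace ℚ)
    (htriv : ∀ (g : ↥(κ.kerSubgroup ⊓ decompInf w)) (m : ↥(W.geomTorsion 2)), g • m = m)
    {g : ↥(κ.kerSubgroup ⊓ decompInf w)} (hg : g ≠ 1) :
    ∃ Tw : ↥(W.geomTorsion 2), Tw ≠ 0 ∧
      (∀ t : ↥(W.geomTorsion 2),
        (∃ a : ↥(W.geomPrimaryTorsion 2), (g : absoluteGaloisGroup ℚ) • a - a =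
            AddSubgroup.inclusion (geomTorsion_le_geomPrimaryTorsion W 2) t) ↔ (t = 0 ∨ t = Tw)) ∧
      ∀ y : subgroupH1 κ.kerSubgroup ↥(W.geomTorsion 2),
        y ∈ (W.fineSelmerInfty κ).comap (W.torsionToPrimaryH1Sub 2 κ.kerSubgroup) ↔
          (∀ (v : HeightOneSpectrum (𝓞 ℚ)) (σ : absoluteGaloisGroup ℚ),
              resOfLe (↥(W.geomPrimaryTorsion 2)) (inf_le_left : κ.kerSubgroup ⊓ decomp v ≤ κ.kerSubgroup)
                (W.torsionToPrimaryH1Sub 2 κ.kerSubgroup (conjH1 κ.kerSubgroup (↥(W.geomTorsion 2)) σ y)) = 0) ∧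
            ∀ σ : absoluteGaloisGroup ℚ,
              evalH1 htriv g (resOfLe (↥(W.geomTorsion 2)) (inf_le_left : κ.kerSubgroup ⊓ decompInf w ≤ κ.kerSubgroup)
                  (conjH1 κ.kerSubgroup (↥(W.geomTorsion 2)) σ y)) = 0 ∨
                evalH1 htriv g (resOfLe (↥(W.geomTorsion 2)) (inf_le_left : κ.kerSubgroup ⊓ decompInf w ≤ κ.kerSubgroup)
                  (conjH1 κ.kerSubgroup (↥(W.geomTorsion 2)) σ y)) = Tw := by
  obtain ⟨Tw, hTw0, hline, hiff⟩ :=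
    RealKummerLine.exists_kummerLetter_torsionToPrimaryH1Sub_mem_infKer_iff W κ.kerSubgroup w hΔ htriv hg
  refine ⟨Tw, hTw0, hline, fun y ↦ ?_⟩
  have hmem := mem_comap_fineSelmerInfty_iff W κ (p := 2) y
  rw [hmem]
  refine and_congr Iff.rfl ⟨fun h σ ↦ (hiff _).mp (h w σ), fun h w' σ ↦ ?_⟩
  rw [Subsingleton.elim w' w]
  exact (hiff _).mpr (h σ)

/-- **THE EXACT `E[2]`-TWIN OF (A)₂ ON THE `Δ_E > 0` HALF-CELL.** For `E/ℚ` with `Δ_E > 0` and a `ℤ₂`-extension `κ` with `ker κ ⊓ D_w ∋ g ≠ 1`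
(the cyclotomic one: `D_w ≤ ker κ`): statement (A)₂ — `Sel₀(ℚ_∞, E[2^∞])[2]` finite — holds iff the set of classes `y ∈ H¹(ℚ_∞, E[2])`
satisfying (i) the pulled-back fine conditions at the finite places and (ii) `ev_w(conj_σ y) ∈ {O, T_w}` for every `σ` (the KUMMER LINE at
every real place-conjugate) is finite. This is the correct form on `Δ_E > 0` of PERFECT-DESCENT §3 (v) «(A)₂ ⟺ Sel₀(ℚ_∞, E[2]) finite»,
whose strict reading (condition `ev_w = 0`, two bits per real place) was only an implication there (crux workfile RELAXED-COEFFICIENTS-att-p5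
§3): the true archimedean condition is ONE bit, the Kummer line. [cite: GreenbergLNM1716, §4 Lemma 4.6 and p. 106]
[cite: LimSujatha2018, §3 (proof of Prop. 3.2)] [cite: CoatesSujatha2005, §3 (statement (A))] -/
theorem exists_kummerLetter_finite_twoTorsion_iff (hΔ : 0 < W.Δ) (w : InfinitePlace ℚ)
    (htriv : ∀ (g : ↥(κ.kerSubgroup ⊓ decompInf w)) (m : ↥(W.geomTorsion 2)), g • m = m)
    {g : ↥(κ.kerSubgroup ⊓ decompInf w)} (hg : g ≠ 1) :
    ∃ Tw : ↥(W.geomTorsion 2), Tw ≠ 0 ∧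
      (∀ t : ↥(W.geomTorsion 2),
        (∃ a : ↥(W.geomPrimaryTorsion 2), (g : absoluteGaloisGroup ℚ) • a - a =
            AddSubgroup.inclusion (geomTorsion_le_geomPrimaryTorsion W 2) t) ↔ (t = 0 ∨ t = Tw)) ∧
      (Set.Finite {s : W.fineSelmerInfty κ | 2 • s = 0} ↔
        Set.Finite {y : subgroupH1 κ.kerSubgroup ↥(W.geomTorsion 2) |
          (∀ (v : HeightOneSpectrum (𝓞 ℚ)) (σ : absoluteGaloisGroup ℚ),
              resOfLe (↥(W.geomPrimaryTorsion 2)) (inf_le_left : κ.kerSubgroup ⊓ decomp v ≤ κ.kerSubgroup)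
                (W.torsionToPrimaryH1Sub 2 κ.kerSubgroup (conjH1 κ.kerSubgroup (↥(W.geomTorsion 2)) σ y)) = 0) ∧
            ∀ σ : absoluteGaloisGroup ℚ,
              evalH1 htriv g (resOfLe (↥(W.geomTorsion 2)) (inf_le_left : κ.kerSubgroup ⊓ decompInf w ≤ κ.kerSubgroup)
                  (conjH1 κ.kerSubgroup (↥(W.geomTorsion 2)) σ y)) = 0 ∨
                evalH1 htriv g (resOfLe (↥(W.geomTorsion 2)) (inf_le_left : κ.kerSubgroup ⊓ decompInf w ≤ κ.kerSubgroup)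
                  (conjH1 κ.kerSubgroup (↥(W.geomTorsion 2)) σ y)) = Tw}) := by
  obtain ⟨Tw, hTw0, hline, hiff⟩ := exists_kummerLetter_mem_comap_fineSelmerInfty_iff W κ hΔ w htriv hg
  refine ⟨Tw, hTw0, hline, ?_⟩
  rw [finite_fineSelmerInfty_pTorsion_iff_finite_comap W κ (p := 2)]
  have hset : ((W.fineSelmerInfty κ).comap (W.torsionToPrimaryH1Sub 2 κ.kerSubgroup) :
      Set (subgroupH1 κ.kerSubgroup ↥(W.geomTorsion 2))) = {y | _} := Set.ext fun y ↦ hiff y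
  exact ⟨fun h ↦ by rwa [← hset], fun h ↦ by rwa [hset]⟩

/-- **Cyclotomic instance, hypothesis-light**: for the CYCLOTOMIC `ℤ₂`-extension and `Δ_E > 0`, (A)₂ holds iff the pull-back
`ι_*⁻¹(Sel₀(ℚ_∞, E[2^∞])) ≤ H¹(ℚ_∞, E[2])` is finite; by `exists_kummerLetter_mem_comap_fineSelmerInfty_iff` (with `D_w ≤ ker κ`,
att-p5 g8 `RealKummerWitness.decompInf_le_kerSubgroup`) that pull-back is the Kummer-line fine group. [cite: GreenbergLNM1716, §4 p. 106]
[cite: LimSujatha2018, §3 (proof of Prop. 3.2)] -/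
theorem finite_twoTorsion_iff_finite_comap :
    Set.Finite {s : W.fineSelmerInfty κ | 2 • s = 0} ↔
      Set.Finite ((W.fineSelmerInfty κ).comap (W.torsionToPrimaryH1Sub 2 κ.kerSubgroup) :
        Set (subgroupH1 κ.kerSubgroup ↥(W.geomTorsion 2))) :=
  finite_fineSelmerInfty_pTorsion_iff_finite_comap W κ (p := 2)

/-- For the cyclotomic `κ` and `Δ_E > 0` there IS a non-trivial `g ∈ ker κ ⊓ D_w`, and `ker κ ⊓ D_w` fixes `E[2]` — the hypotheses of
`exists_kummerLetter_finite_twoTorsion_iff` are met (att-p5 g8 `RealKummerWitness.decompInf_le_kerSubgroup` /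
`forall_smul_eq_of_Δ_pos`, `RealKummerIndex.exists_ne_one_inf_decompInf`). [cite: Washington1997, §13.1] [cite: SilvermanAEC2009, III.1] -/
theorem exists_ne_one_and_smul_eq_self (hκ : κ.IsCyclotomic) (hΔ : 0 < W.Δ) (w : InfinitePlace ℚ) :
    (∃ g : ↥(κ.kerSubgroup ⊓ decompInf w), g ≠ 1) ∧
      ∀ (g : ↥(κ.kerSubgroup ⊓ decompInf w)) (m : ↥(W.geomTorsion 2)), g • m = m :=
  ⟨RealKummerIndex.exists_ne_one_inf_decompInf (IsTotallyReal.isReal w) κ.kerSubgroup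
      (RealKummerWitness.decompInf_le_kerSubgroup κ hκ (IsTotallyReal.isReal w)),
    RealKummerIndex.smul_eq_self_inf_decompInf W (RealKummerWitness.forall_smul_eq_of_Δ_pos W hΔ w) κ.kerSubgroup⟩

omit [W.IsElliptic] in
/-- **Comparison with the STRICT `E[2]`-reading** (`Δ_E > 0`, cyclotomic): the Literature's fine group `Sel₀(ℚ_∞, E[2])` (archimedean
condition `ev_w = 0` at every real place-conjugate) is contained in the Kummer-line fine group `ι_*⁻¹(Sel₀(ℚ_∞, E[2^∞]))` (condition
`ev_w ∈ {O, T_w}`); locally at each real place the former condition has index `2` in the latter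
(`RealKummerLine.relIndex_infKer_comap_eq_two`). So «(A)₂ ⟹ `Sel₀(ℚ_∞, E[2])` finite» (att-p5 g4 `TorsionCoefficients`) is the
necessity half of the exact twin. [cite: GreenbergLNM1716, §4 Lemma 4.6 and p. 106] -/
theorem fineSelmerInfty_twoCoeff_le_comap :
    fineSelmerInfty (↥(W.geomTorsion 2)) κ ≤ (W.fineSelmerInfty κ).comap (W.torsionToPrimaryH1Sub 2 κ.kerSubgroup) :=
  fineSelmerInfty_torsion_le_comap W κ (p := 2)

end RatTwo

end Summit.BirchSwinnertonDyer.BirchSwinnertonDyer.Theorems.AlignedTransportAtTwoFineRoad.RealKummerSelmer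

end
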